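import Summits.RiemannHypothesis.RiemannHypothesis.Theorems.TiltedLandingLaw421R3Lens1ArcSignG

/-!
# TiltedLandingLaw421R3 — lens-1: RUNG 3 and the CONVERSION proved (part H: `PinningOfNetNonAscending`, `PinningOfArcCount`)

LENS-1 gen-6 module image `rh33346-cover/lens-1/ArcSignH-v1.lean` (landing target `…/Theorems/TiltedLandingLaw421R3Lens1ArcSignH.lean`; single import =
part G; namespace `RhW08.Lens1ArcSign`; 0 `sorry`, no instances / notation; checked BY CHAIN over the ArcSign A–G images until tree).

THE ARGUMENT (memo O6d §1–§4).  On `a`ʼs own Jensen circle `C_δ : |w − Re a| = Im a + δ` (generic small `δ`: zero-free for `G = f^{(j)}` and `G′`,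
outside the hypothesisʼs finite exceptional set) part Gʼs exact loop identity and the argument principle give the DISC CENSUS WITH COUNT
  `2(N_D(G′) − N_D(G)) = sgn φ(left foot) − sgn φ(right foot) + 4(#desc − #asc)`            (`disc_census_count`),
and on a `LocalB` base (else an NL event in the closed base) with every critical point in the open disc real (else a `NestedStep` child) the real Rolle
identity turns it into  `N = nonrealZeroMult G = 2(#asc − #desc)`  (`nonrealZeroMult_eq_of_count`).  The count law `2(#asc − #desc) ≤ N − 2` is then
absurd: ★ `pinning_of_arcCount : PinningOfArcCount`; RUNG 3 ★ `pinning_of_netNonAscending : PinningOfNetNonAscending` follows by part Fʼs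
`rung3_of_arcCount` (`N ≥ 2`: `a` and `conj a`), and RUNG 2 / RUNG 1 are recovered through `rung2_of_rung3` / `rung1_of_rung2`.

CONTENT: §1 `disc_census_count` · §2 `nonrealZeroMult_eq_of_count` · §3 ★ `pinning_of_arcCount_cofinite`, ★ `pinning_of_arcCount`,
★ `pinning_of_netNonAscending` · §4 the law ⟺ its net-ascending residual: `topPinning_of_netAscResidual`,
`topPinning_iff_netAscResidual`, `topPinningCrossing_of_netAscResidual`.

HONEST LABEL: after this part the OPEN content of `TopPinning` is exactly `TopPinningNetAscResidual` (tops one of whose small circles carries MORE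
ascending than descending bad arcs; instrument: ≤ 24 / 6 386 legal crossing tops, the right-foot `K = −2` family).  `TopPinning`, `TopPinningCrossing`,
`RegUmbrella11S`, 33346, 33347 remain OPEN; nothing here bears on the truth of RH; RH is not proved; checked ≠ proved.
-/

noncomputable section

namespace RhW08.Lens1ArcSign

open Complex Set Metric Filter Topology
open scoped Real
open Literature.Topology.PlaneTopology Literature.Analysis.Complex
open Summit.RiemannHypothesis.RiemannHypothesis.Theorems.Splittings.JensenWindow
open RhIdea6.G17.W07C7 RhIdea6.G17.W07C7.Rev6 RhIdea6.G18.W07C8.Law421BirthS RhIdea6.G19.W07C11.Seam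
open RhIdea6.G20.W07C12.Frac RhIdea6.G20.W07C12.StColP RhW07.C12.FieldSplit RhIdea6.G21.W07C13.TentMax
open RhW07.C14.TwoSided RhW07.C14.Classes RhW07.C14.Lineage RhW07.C14.Booking
open RhW07.C13.Heredity RhIdea6.G22.W07C15pre.Injection RhW07.E3.Cell RhW07.E3.Lit
open RhW08.Round1 RhW08.StSwap RhW08.Round2 RhW08.QuadW RhW08.SealSwapQ RhW08.SealSwap RhW08.SuccB RhW08.SuccSplit
open RhW08.SuccTheft RhW08.Column RhW08.Hurwitz RhW08.ClusterQ RhW08.ClusterQM RhW08.NewtonDoor RhW08.NewtonDoorGenusOne RhW08.PurseP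
open RhW08.Lens1SignCut RhW08.Lens1Coverage RhW08.IsolatedTilt RhW08.Lens1Pinning RhW08.Lens1PinningIso

variable {f : ℂ → ℂ}

/-! ## §1 The disc census with count -/

/-- ★ DISC CENSUS WITH COUNT.  `f` real entire, the circle `|u − c| = r` free of zeros of `f` and `f′` ⇒
`2(N_D(f′) − N_D(f)) = sgn Re φ(c − r) − sgn Re φ(c + r) + 4(#desc − #asc)` (`φ = f′/f` along `circleLoop c r`; both counts finite). -/
theorem disc_census_count {f : ℂ → ℂ} (hfd : Differentiable ℂ f) (hreal : ∀ x : ℝ, (f x).im = 0) {c r : ℝ} (hr : 0 < r)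
    (hf0 : ∀ u : ℂ, ‖u - c‖ = r → f u ≠ 0) (hd0 : ∀ u : ℂ, ‖u - c‖ = r → deriv f u ≠ 0) :
    (ascSet (fun t => deriv f (circleLoop (c : ℂ) r t) / f (circleLoop (c : ℂ) r t))).Finite ∧
    (descSet (fun t => deriv f (circleLoop (c : ℂ) r t) / f (circleLoop (c : ℂ) r t))).Finite ∧
    2 * (zeroCountC (deriv f) (ball (c : ℂ) r) - zeroCountC f (ball (c : ℂ) r)) =
      sgn (deriv f ((c - r : ℝ) : ℂ) / f ((c - r : ℝ) : ℂ)).re - sgn (deriv f ((c + r : ℝ) : ℂ) / f ((c + r : ℝ) : ℂ)).re +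
        4 * (((descSet (fun t => deriv f (circleLoop (c : ℂ) r t) / f (circleLoop (c : ℂ) r t))).ncard : ℂ) -
          ((ascSet (fun t => deriv f (circleLoop (c : ℂ) r t) / f (circleLoop (c : ℂ) r t))).ncard : ℂ)) := by
  have hγr : ∀ t : ℝ, ‖circleLoop (c : ℂ) r t - c‖ = r := fun t => by rw [norm_circleLoop_sub_center, abs_of_pos hr]
  have hcf : Continuous fun t : ℝ => f (circleLoop (c : ℂ) r t) := hfd.continuous.comp (continuous_circleLoop _ _)
  have hcd : Continuous fun t : ℝ => deriv f (circleLoop (c : ℂ) r t) := hfd.deriv.continuous.comp (continuous_circleLoop _ _)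
  have hF : IsNonvanishingLoop (fun t => f (circleLoop (c : ℂ) r t)) :=
    ⟨hcf.continuousOn, fun t _ => hf0 _ (hγr t), by simp only [circleLoop_zero_eq]⟩
  have hF' : IsNonvanishingLoop (fun t => deriv f (circleLoop (c : ℂ) r t)) :=
    ⟨hcd.continuousOn, fun t _ => hd0 _ (hγr t), by simp only [circleLoop_zero_eq]⟩
  have hdiv : wind (fun t => deriv f (circleLoop (c : ℂ) r t) / f (circleLoop (c : ℂ) r t)) =
      wind (fun t => deriv f (circleLoop (c : ℂ) r t)) - wind (fun t => f (circleLoop (c : ℂ) r t)) := wind_div hF' hF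
  have hWf := wind_circleLoop_eq_zeroCountC hfd hr hf0
  have hWd := wind_circleLoop_eq_zeroCountC hfd.deriv hr hd0
  have hΓc : ContinuousOn (fun t => deriv f (circleLoop (c : ℂ) r t) / f (circleLoop (c : ℂ) r t)) (Icc 0 1) :=
    hcd.continuousOn.div hcf.continuousOn fun t _ => hf0 _ (hγr t)
  have h01 : deriv f (circleLoop (c : ℂ) r 0) / f (circleLoop (c : ℂ) r 0) =
      deriv f (circleLoop (c : ℂ) r 1) / f (circleLoop (c : ℂ) r 1) := by rw [circleLoop_zero_eq]
  have hne : ∀ t ∈ Icc (0 : ℝ) 1, deriv f (circleLoop (c : ℂ) r t) / f (circleLoop (c : ℂ) r t) ≠ 0 :=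
    fun t _ => div_ne_zero (hd0 _ (hγr t)) (hf0 _ (hγr t))
  have hfreal : ∀ z : ℂ, f ((starRingEnd ℂ) z) = (starRingEnd ℂ) (f z) := apply_conj_eq_conj hfd hreal
  have hdreal : ∀ x : ℝ, (deriv f x).im = 0 := im_deriv_ofReal hfd hreal
  have hd'real : ∀ z : ℂ, deriv f ((starRingEnd ℂ) z) = (starRingEnd ℂ) (deriv f z) := apply_conj_eq_conj hfd.deriv hdreal
  have hsym : ∀ t ∈ Icc (0 : ℝ) 1, deriv f (circleLoop (c : ℂ) r (1 - t)) / f (circleLoop (c : ℂ) r (1 - t)) =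
      (starRingEnd ℂ) (deriv f (circleLoop (c : ℂ) r t) / f (circleLoop (c : ℂ) r t)) := by
    intro t _
    rw [circleLoop_one_sub, hd'real, hfreal, map_div₀]
  have hZ := breaks_finite_or_flat hfd (c := c) (r := r) (fun t => hf0 _ (hγr t))
  obtain ⟨hA, hD, hn⟩ := two_mul_wind_eq_count hΓc h01 hne hsym hZ
  refine ⟨hA, hD, ?_⟩
  rw [circleLoop_ofReal_half, circleLoop_ofReal_zero, hdiv, Int.cast_sub, hWd, hWf] at hn
  exact hn

/-! ## §2 Disc Rolle closure with count -/

/-- ★ DISC ROLLE CLOSURE WITH COUNT (twin of `no_nonreal_zero_of_disc_ge`).  If the disc census holds with counts `#asc = A`, `#desc = D`, every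
critical point in the open disc is real and the real Rolle identity holds on the base, then the non-real zeros of `f` in the disc number
`N = 2(A − D)` with multiplicity. -/
theorem nonrealZeroMult_eq_of_count {f : ℂ → ℂ} (hfd : Differentiable ℂ f) {c r : ℝ} (hr : 0 < r)
    (hf0 : ∀ u : ℂ, ‖u - c‖ = r → f u ≠ 0) {A D : ℕ}
    (hc : 2 * (zeroCountC (deriv f) (ball (c : ℂ) r) - zeroCountC f (ball (c : ℂ) r)) =
      sgn (deriv f ((c - r : ℝ) : ℂ) / f ((c - r : ℝ) : ℂ)).re - sgn (deriv f ((c + r : ℝ) : ℂ) / f ((c + r : ℝ) : ℂ)).re +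
        4 * ((D : ℂ) - (A : ℂ)))
    (hA : ∀ ρ ∈ ball (c : ℂ) r, deriv f ρ = 0 → ρ.im = 0) (hR : RolleIdentity f (c - r) (c + r) r) :
    nonrealZeroMult f c r = 2 * ((A : ℤ) - D) := by
  classical
  unfold nonrealZeroMult
  set K : Set ℂ := ball (c : ℂ) r with hKdef
  have hfin : {ρ : ℂ | f ρ = 0 ∧ ρ ∈ K}.Finite := by
    refine (Rouche.finite_zeros f hr (by linarith : r < r + 1) hfd.differentiableOn hf0).subset ?_
    rintro ρ ⟨h0, hρ⟩
    exact ⟨ball_subset_closedBall hρ, h0⟩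
  have e1 : {ρ : ℂ | deriv f ρ = 0 ∧ ρ ∈ K} = {ρ : ℂ | deriv f ρ = 0 ∧ ρ ∈ K ∩ {ρ | ρ.im = 0}} := by
    ext ρ
    simp only [mem_setOf_eq, mem_inter_iff]
    constructor
    · rintro ⟨h0, hK⟩; exact ⟨h0, hK, hA ρ hK h0⟩
    · rintro ⟨h0, hK, -⟩; exact ⟨h0, hK⟩
  have e1' : zeroCountC (deriv f) K = zeroCountC (deriv f) (K ∩ {ρ | ρ.im = 0}) := by
    unfold zeroCountC; rw [e1]
  set B : Set ℂ := {ρ : ℂ | f ρ = 0 ∧ ρ ∈ K ∧ ρ.im ≠ 0} with hBdef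
  have e2 : {ρ : ℂ | f ρ = 0 ∧ ρ ∈ K} = {ρ : ℂ | f ρ = 0 ∧ ρ ∈ K ∩ {ρ | ρ.im = 0}} ∪ B := by
    ext ρ
    simp only [mem_setOf_eq, mem_inter_iff, mem_union, hBdef]
    constructor
    · rintro ⟨h0, hK⟩
      by_cases him : ρ.im = 0
      · exact Or.inl ⟨h0, hK, him⟩
      · exact Or.inr ⟨h0, hK, him⟩
    · rintro (⟨h0, hK, -⟩ | ⟨h0, hK, -⟩) <;> exact ⟨h0, hK⟩
  have hdisj : Disjoint {ρ : ℂ | f ρ = 0 ∧ ρ ∈ K ∩ {ρ | ρ.im = 0}} B := by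
    rw [Set.disjoint_left]
    rintro ρ ⟨-, -, him⟩ ⟨-, -, him'⟩
    exact him' him
  have hAfin : {ρ : ℂ | f ρ = 0 ∧ ρ ∈ K ∩ {ρ | ρ.im = 0}}.Finite := hfin.subset fun ρ hρ => ⟨hρ.1, hρ.2.1⟩
  have hBfin : B.Finite := hfin.subset fun ρ hρ => ⟨hρ.1, hρ.2.1⟩
  have e2' : zeroCountC f K = zeroCountC f (K ∩ {ρ | ρ.im = 0}) + ∑ᶠ ρ ∈ B, ((meromorphicOrderAt f ρ).untop₀ : ℂ) := by
    unfold zeroCountC; rw [e2, finsum_mem_union hdisj hAfin hBfin]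
  have hB0 : 2 * ∑ᶠ ρ ∈ B, ((meromorphicOrderAt f ρ).untop₀ : ℂ) + 4 * ((D : ℂ) - (A : ℂ)) = 0 := by
    rw [e1', e2'] at hc
    unfold RolleIdentity at hR
    rw [zeroCountC_box_real_eq, zeroCountC_box_real_eq] at hR
    linear_combination hR - hc
  rw [finsum_mem_eq_finite_toFinset_sum _ hBfin, ← Int.cast_sum] at hB0
  have hB0' : 2 * ∑ ρ ∈ hBfin.toFinset, (meromorphicOrderAt f ρ).untop₀ + 4 * ((D : ℤ) - A) = 0 := by exact_mod_cast hB0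
  rw [finsum_mem_eq_finite_toFinset_sum _ hBfin]
  linarith

/-! ## §3 RUNG 3 and the CONVERSION -/

/-- ★★★ THE CONVERSION, frame form.  On a legal frame, an upper zero `a` of `f^{(j)}` whose small Jensen circles `|w − Re a| = Im a + δ`
(`0 < δ < d₀`, `δ` outside a finite set) satisfy the count law `2(#asc − #desc) ≤ N − 2` has a NON-REAL zero of `f^{(j+1)}` in its CLOSED Jensen disc
or an NL event of level `j` in the CLOSED base.  [Walsh, Ann. of Math. 22 (1920) §4 on `a`ʼs own circle; memo O6d (WORD)/(PIN).] -/
theorem pinning_of_arcCount_cofinite {η : ℝ} {f : ℂ → ℂ} {x₀ s hmax R Hs : ℝ} {B : ℕ} (hE : EngineHyps5 2 η f x₀ s hmax R Hs B)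
    {j : ℕ} {a : ℂ} (ha : iteratedDeriv j f a = 0) (hapos : 0 < a.im) (hAC : ArcCountLaw f j a) :
    (∃ w : ℂ, iteratedDeriv (j + 1) f w = 0 ∧ w.im ≠ 0 ∧ NestedStep a w) ∨ (∃ x : ℝ, |x - a.re| ≤ a.im ∧ NLEventOf f j x) := by
  classical
  have hf : RealEntireLt2 f := realEntireLt2_of_hyps hE
  -- degenerate frame `f^{(j)} ≡ 0`: `a` itself is a child
  by_cases hnz : iteratedDeriv j f = 0
  · left
    refine ⟨a, ?_, hapos.ne', ?_⟩
    · rw [iteratedDeriv_succ, hnz]; simp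
    · show (a.re - a.re) ^ 2 + a.im ^ 2 ≤ a.im ^ 2
      simp
  set G : ℂ → ℂ := iteratedDeriv j f with hGdef
  have hG : RealEntireLt2 G :=
    { diff := differentiable_iteratedDeriv_of_entire hf.diff j
      growth := by
        obtain ⟨ρ, C, hρ0, hρ, hgr⟩ := hf.growth
        obtain ⟨ρ', C', h1, h2, h3⟩ := exists_growth_iteratedDeriv hf.diff hρ0 hρ hgr j
        exact ⟨ρ', C', h1, h2, h3⟩
      real := im_iteratedDeriv_ofReal hf.diff hf.real j }
  have e1 : deriv G = iteratedDeriv (j + 1) f := by rw [hGdef, ← iteratedDeriv_succ]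
  have hHs : 0 ≤ Hs := hE.2.2.2.2.2.2.2.1
  have hG'ne : iteratedDeriv (j + 1) f ≠ 0 := iteratedDeriv_succ_ne_zero_of_zero hf.diff j hnz ha
  have hG'd : Differentiable ℂ (iteratedDeriv (j + 1) f) := differentiable_iteratedDeriv_of_entire hf.diff (j + 1)
  obtain ⟨d0, hd0, E, hEfin, hcount⟩ := hAC
  by_contra hcon
  push Not at hcon
  obtain ⟨hnoC, hnoNL⟩ := hcon
  obtain ⟨m, hm0, hm1, hmarg⟩ := exists_nl_margin hf hG'ne hapos (a := a)
  obtain ⟨m', hm'0, hm'1, hchild⟩ := exists_child_margin hE hG'ne hapos (a := a)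
  set δ₀ : ℝ := min d0 (min m m') with hδ₀
  have hδ₀0 : 0 < δ₀ := lt_min hd0 (lt_min hm0 hm'0)
  -- a GENERIC `δ ∈ (0, δ₀)`: the whole circle of radius `Im a + δ` misses the finitely many zeros of `G`, `G′` in the box, and `δ ∉ E`
  set L : ℝ := a.im + Hs + 2 with hL
  have hz₀ : ((a.re : ℂ)) ∈ Ioo (a.re - L) (a.re + L) ×ℂ Ioo (-(Hs + 1)) (Hs + 1) :=
    ofReal_mem_box (by rw [sub_self, abs_zero]; linarith) hHs
  set Z : Set ℂ := {ρ : ℂ | G ρ = 0 ∧ ρ ∈ Ioo (a.re - L) (a.re + L) ×ℂ Ioo (-(Hs + 1)) (Hs + 1)} ∪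
    {ρ : ℂ | iteratedDeriv (j + 1) f ρ = 0 ∧ ρ ∈ Ioo (a.re - L) (a.re + L) ×ℂ Ioo (-(Hs + 1)) (Hs + 1)} with hZ
  have hZfin : Z.Finite := (finite_zeros_box hG.diff hnz hz₀).union (finite_zeros_box hG'd hG'ne hz₀)
  have hbad : ((fun ρ : ℂ => ‖ρ - (a.re : ℂ)‖ - a.im) '' Z ∪ E).Finite := (hZfin.image _).union hEfin
  obtain ⟨δ, hδI, hδbad⟩ := ((Set.Ioo_infinite hδ₀0).sdiff hbad).nonempty
  obtain ⟨hδ0, hδ1⟩ := hδI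
  have hδd0 : δ < d0 := lt_of_lt_of_le hδ1 (min_le_left _ _)
  have hδm : δ < m := lt_of_lt_of_le hδ1 ((min_le_right _ _).trans (min_le_left _ _))
  have hδm' : δ < m' := lt_of_lt_of_le hδ1 ((min_le_right _ _).trans (min_le_right _ _))
  have hr : 0 < a.im + δ := by linarith
  -- the circle lies in the box
  have hbox : ∀ u : ℂ, ‖u - (a.re : ℂ)‖ = a.im + δ → u ∈ Ioo (a.re - L) (a.re + L) ×ℂ Ioo (-(Hs + 1)) (Hs + 1) := by
    intro u hu
    have haHs : |a.im| ≤ Hs := abs_im_le_of_level hE hnz ha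
    rw [abs_of_pos hapos] at haHs
    have h1 := abs_re_le_norm (u - (a.re : ℂ))
    have h2 := abs_im_le_norm (u - (a.re : ℂ))
    rw [hu] at h1 h2
    rw [sub_re, ofReal_re, abs_le] at h1
    rw [sub_im, ofReal_im, sub_zero, abs_le] at h2
    exact mem_reProdIm.2 ⟨⟨by linarith [h1.1], by linarith [h1.2]⟩, ⟨by linarith [h2.1], by linarith [h2.2]⟩⟩
  have hG0 : ∀ u : ℂ, ‖u - ((a.re : ℝ) : ℂ)‖ = a.im + δ → G u ≠ 0 := fun u hu h0 =>
    hδbad (Or.inl ⟨u, Or.inl ⟨h0, hbox u hu⟩, by simp only [hu]; ring⟩)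
  have hG'0 : ∀ u : ℂ, ‖u - ((a.re : ℝ) : ℂ)‖ = a.im + δ → iteratedDeriv (j + 1) f u ≠ 0 := fun u hu h0 =>
    hδbad (Or.inl ⟨u, Or.inr ⟨h0, hbox u hu⟩, by simp only [hu]; ring⟩)
  have hδE : δ ∉ E := fun h => hδbad (Or.inr h)
  have hdG0 : ∀ u : ℂ, ‖u - ((a.re : ℝ) : ℂ)‖ = a.im + δ → deriv G u ≠ 0 := by rw [e1]; exact hG'0
  -- the count law at this `δ`
  obtain ⟨-, hineq⟩ := hcount δ ⟨⟨hδ0, hδd0⟩, hδE⟩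
  have hineq' : 2 * (((ascStarts f j a δ).ncard : ℤ) - (descStarts f j a δ).ncard) ≤ nonrealZeroMult G a.re (a.im + δ) - 2 := hineq
  -- the feet
  have hβ : ‖((a.re + (a.im + δ) : ℝ) : ℂ) - ((a.re : ℝ) : ℂ)‖ = a.im + δ := by
    rw [← ofReal_sub, show a.re + (a.im + δ) - a.re = a.im + δ by ring, Complex.norm_real, Real.norm_eq_abs, abs_of_pos hr]
  have hα : ‖((a.re - (a.im + δ) : ℝ) : ℂ) - ((a.re : ℝ) : ℂ)‖ = a.im + δ := by
    rw [← ofReal_sub, show a.re - (a.im + δ) - a.re = -(a.im + δ) by ring, Complex.norm_real, Real.norm_eq_abs, abs_neg,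
      abs_of_pos hr]
  have hGβ : G ((a.re + (a.im + δ) : ℝ) : ℂ) ≠ 0 := hG0 _ hβ
  have hGα : G ((a.re - (a.im + δ) : ℝ) : ℂ) ≠ 0 := hG0 _ hα
  have hdGβ : deriv G ((a.re + (a.im + δ) : ℝ) : ℂ) ≠ 0 := hdG0 _ hβ
  have hdGα : deriv G ((a.re - (a.im + δ) : ℝ) : ℂ) ≠ 0 := hdG0 _ hα
  -- the base: local Laguerre law B, or an NL event within the margin
  by_cases hB : LocalB G (a.re - (a.im + δ)) (a.re + (a.im + δ))
  swap
  · obtain ⟨x, hx, hNL⟩ := nlEventOf_of_not_localB hf j hB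
    have hxa : |x - a.re| < a.im + m := by rw [abs_lt]; constructor <;> linarith [hx.1, hx.2]
    exact hnoNL x (hmarg x hNL hxa) hNL
  have hW : SWindow G (fun _ => True) (a.re - (a.im + δ)) (a.re + (a.im + δ)) (a.im + δ) :=
    ⟨by linarith, hr, fun _ _ => trivial, fun _ _ => trivial, fun _ _ _ => trivial, fun _ _ _ => trivial, hGα, hGβ, hdGα, hdGβ⟩
  have hRolle : RolleIdentity G (a.re - (a.im + δ)) (a.re + (a.im + δ)) (a.im + δ) :=
    rolleIdentity_of_localB_core hG.diff hG.real hW hB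
  -- every critical point in the open disc is real — else it is a `NestedStep` child (excluded)
  have hA : ∀ ρ ∈ ball ((a.re : ℝ) : ℂ) (a.im + δ), deriv G ρ = 0 → ρ.im = 0 := by
    intro ρ hρ hdρ
    by_contra hρim
    have hρ' : ‖ρ - (a.re : ℂ)‖ < a.im + m' := by
      rw [mem_ball, dist_eq_norm] at hρ; linarith
    have hdρ' : iteratedDeriv (j + 1) f ρ = 0 := by rw [← e1]; exact hdρ
    exact hnoC ρ hdρ' hρim (hchild ρ hdρ' hρim hρ')
  -- the census with count on the circle and the disc Rolle closure: `N = 2(#asc − #desc)`, against the count law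
  obtain ⟨-, -, hc⟩ := disc_census_count hG.diff hG.real hr hG0 hdG0
  have hN := nonrealZeroMult_eq_of_count hG.diff hr hG0 hc hA hRolle
  have hN' : nonrealZeroMult G a.re (a.im + δ) = 2 * (((ascStarts f j a δ).ncard : ℤ) - (descStarts f j a δ).ncard) := hN
  omega

/-- ★★★ THE CONVERSION (`PinningOfArcCount`, typed in part F): the count law on the small circles ⇒ the `TopPinning` disjunction. -/
theorem pinning_of_arcCount : PinningOfArcCount :=
  fun _ _ _ _ _ _ _ _ hE _ _ ha hapos hAC => pinning_of_arcCount_cofinite hE ha hapos hAC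

/-- ★★★ RUNG 3 (`PinningOfNetNonAscending`, typed in part F): net non-ascent `#asc ≤ #desc` on the small circles ⇒ the `TopPinning` disjunction. -/
theorem pinning_of_netNonAscending : PinningOfNetNonAscending :=
  rung3_of_arcCount pinning_of_arcCount

/-! ## §4 The law is its net-ascending residual -/

/-- ★ After RUNG 3 the law reduces to its net-ascending residual: `TopPinningNetAscResidual → TopPinning`. -/
theorem topPinning_of_netAscResidual (h4 : TopPinningNetAscResidual) : TopPinning :=
  topPinning_of_rung3 pinning_of_netNonAscending h4

/-- ★ `TopPinning ⟺ TopPinningNetAscResidual`: the open content of the law is the net-ascending class. -/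
theorem topPinning_iff_netAscResidual : TopPinning ↔ TopPinningNetAscResidual :=
  ⟨netAscResidual_of_topPinning, topPinning_of_netAscResidual⟩

/-- ★ … and `TopPinningCrossing` from the same residual. -/
theorem topPinningCrossing_of_netAscResidual (h4 : TopPinningNetAscResidual) : TopPinningCrossing :=
  topPinningCrossing_of_ascResidual (ascResidual_of_rung3 pinning_of_netNonAscending h4)

end RhW08.Lens1ArcSign
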